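import Summits.AtomisticToContinuum.Crystallization.Theorems.FrustratedLawDichotomyStrainedPatchHomCoords
import Summits.AtomisticToContinuum.Crystallization.Theorems.FrustratedLawDichotomyStrainedPatchHomCentredForm

/-!
# Leaf calculus for the `HomFloor` certificate: Gram data from entries, and the chain rule for `W ∘ √` (def-free)

decomp-a2c hand-1 g19 (rows 764/769; CERT-DESIGN-g44 §1–2).  Two small services for a reflected (P4) leaf checker:
* §1 ENTRIES → GRAM DATA: `inner_apply_apply_eq_sum_entries` — `⟪U v, U w⟫ = Σₐ (Σ_b U_ab v_b)(Σ_c U_ac w_c)`, so a leaf box in the entry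
  coordinates of `…HomCover.homFloor_of_entryCover` yields (by interval arithmetic on an explicit polynomial) the Gram box consumed by
  `…HomGram.boxSum_ge_of_gramLeaf` / `…HomGramHcp.boxSumHcp_ge_of_gramLeaf` («interval squaring», critic row 769);
* §2 THE UNIVARIATE TERM `φ = W ∘ √`: first and second derivative by the chain rule on `q > 0`
  (`hasDerivAt_comp_sqrt`, `hasDerivAt_deriv_comp_sqrt`), i.e. `φ′(q) = W′(√q)/(2√q)` and
  `φ″(q) = (W″(√q)·√q − W′(√q)) / (4 (√q)³)` — the quantities whose interval bounds give the curvature constants `M` of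
  `…HomCentredForm.monotoneOn_deriv_add_mul_of_le_deriv2`.
Standard axioms; no definitions.  `--supports stmt-AtomisticToContinuum-27623`.
-/

noncomputable section

namespace Summit.AtomisticToContinuum.Crystallization.Theorems.FrustratedLawDichotomyStrainedPatchHomLeafCalculus

open scoped BigOperators RealInnerProductSpace
open Summit.AtomisticToContinuum.Crystallization.Theorems.ChargedEnergyGapNegative (E3)
open Summit.AtomisticToContinuum.Crystallization.Theorems.FrustratedLawDichotomyStrainedPatchHomCoords

/-! ## §1. Gram data from the nine entries -/

/-- `⟪x, y⟫ = Σₐ x a · y a` on `E3`. [folklore] -/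
theorem inner_eq_sum_apply (x y : E3) : ⟪x, y⟫ = ∑ a : Fin 3, x a * y a := by
  rw [PiLp.inner_apply]
  exact Finset.sum_congr rfl fun a _ => by simp [mul_comm]

/-- ★ **Gram datum from entries**: `⟪U v, U w⟫ = Σₐ (Σ_b U_ab v_b)·(Σ_c U_ac w_c)` with `U_ab = (U e_b) a`. [folklore] -/
theorem inner_apply_apply_eq_sum_entries (U : E3 →L[ℝ] E3) (v w : E3) :
    ⟪U v, U w⟫ = ∑ a : Fin 3, (∑ b : Fin 3, (U (EuclideanSpace.single b (1 : ℝ))) a * v b) *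
      (∑ c : Fin 3, (U (EuclideanSpace.single c (1 : ℝ))) a * w c) := by
  rw [inner_eq_sum_apply]
  exact Finset.sum_congr rfl fun a _ => by rw [apply_eq_sum_entries U v a, apply_eq_sum_entries U w a]

/-- Squared length from entries: `‖U v‖² = Σₐ (Σ_b U_ab v_b)²`. [folklore] -/
theorem norm_sq_apply_eq_sum_entries (U : E3 →L[ℝ] E3) (v : E3) :
    ‖U v‖ ^ 2 = ∑ a : Fin 3, (∑ b : Fin 3, (U (EuclideanSpace.single b (1 : ℝ))) a * v b) ^ 2 := by
  rw [← real_inner_self_eq_norm_sq, inner_apply_apply_eq_sum_entries]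
  exact Finset.sum_congr rfl fun a _ => by ring

/-! ## §2. The chain rule for `W ∘ √` -/

/-- ★ **First derivative**: if `W` has derivative `W₁` at `√q` (`q ≠ 0`), then `q ↦ W (√q)` has derivative `W₁ / (2√q)` at `q`. [folklore] -/
theorem hasDerivAt_comp_sqrt {W : ℝ → ℝ} {W₁ q : ℝ} (hq : q ≠ 0) (hW : HasDerivAt W W₁ (Real.sqrt q)) :
    HasDerivAt (fun q => W (Real.sqrt q)) (W₁ / (2 * Real.sqrt q)) q := by
  have h := hW.comp q (Real.hasDerivAt_sqrt hq)
  have e : W₁ * (1 / (2 * Real.sqrt q)) = W₁ / (2 * Real.sqrt q) := by ring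
  rw [← e]; exact h

/-- ★ **Second derivative**: if `W′ = W₁` has derivative `W₂` at `√q` (`0 < q`), then `q ↦ W₁(√q) / (2√q)` has derivative
`(W₂·√q − W₁(√q)) / (4 (√q)³)` at `q`. [folklore] -/
theorem hasDerivAt_deriv_comp_sqrt {W₁ : ℝ → ℝ} {W₂ q : ℝ} (hq : 0 < q) (hW : HasDerivAt W₁ W₂ (Real.sqrt q)) :
    HasDerivAt (fun q => W₁ (Real.sqrt q) / (2 * Real.sqrt q)) ((W₂ * Real.sqrt q - W₁ (Real.sqrt q)) / (4 * Real.sqrt q ^ 3)) q := by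
  have hs : 0 < Real.sqrt q := Real.sqrt_pos.2 hq
  have hq0 : q ≠ 0 := hq.ne'
  have hnum : HasDerivAt (fun q => W₁ (Real.sqrt q)) (W₂ / (2 * Real.sqrt q)) q := hasDerivAt_comp_sqrt hq0 hW
  have hden : HasDerivAt (fun q => 2 * Real.sqrt q) (2 * (1 / (2 * Real.sqrt q))) q :=
    (Real.hasDerivAt_sqrt hq0).const_mul 2
  have h := hnum.div hden (by positivity)
  have e : (W₂ / (2 * Real.sqrt q) * (2 * Real.sqrt q) - W₁ (Real.sqrt q) * (2 * (1 / (2 * Real.sqrt q)))) / (2 * Real.sqrt q) ^ 2 =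
      (W₂ * Real.sqrt q - W₁ (Real.sqrt q)) / (4 * Real.sqrt q ^ 3) := by
    field_simp
    ring
  rw [← e]; exact h

/-- From interval data to the curvature constant: if on `[a,b] ⊂ (0,∞)` one has `W₂(√q)·√q − W₁(√q) ≥ −4·M·(√q)³` then `φ″ ≥ −M` there,
in the form consumed by `…HomCentredForm.monotoneOn_deriv_add_mul_of_le_deriv2`. [folklore] -/
theorem le_deriv2_of_bound {W₁ W₂ : ℝ → ℝ} {M a b : ℝ} (ha : 0 < a)
    (hW : ∀ q ∈ Set.Icc a b, HasDerivAt W₁ (W₂ (Real.sqrt q)) (Real.sqrt q))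
    (hM : ∀ q ∈ Set.Icc a b, -(4 * M * Real.sqrt q ^ 3) ≤ W₂ (Real.sqrt q) * Real.sqrt q - W₁ (Real.sqrt q)) :
    (∀ q ∈ Set.Icc a b, HasDerivAt (fun q => W₁ (Real.sqrt q) / (2 * Real.sqrt q))
        ((W₂ (Real.sqrt q) * Real.sqrt q - W₁ (Real.sqrt q)) / (4 * Real.sqrt q ^ 3)) q) ∧
      ∀ q ∈ Set.Icc a b, -M ≤ (W₂ (Real.sqrt q) * Real.sqrt q - W₁ (Real.sqrt q)) / (4 * Real.sqrt q ^ 3) := by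
  refine ⟨fun q hq => hasDerivAt_deriv_comp_sqrt (ha.trans_le hq.1) (hW q hq), fun q hq => ?_⟩
  have hs : 0 < Real.sqrt q := Real.sqrt_pos.2 (ha.trans_le hq.1)
  have h4 : 0 < 4 * Real.sqrt q ^ 3 := by positivity
  rw [le_div_iff₀ h4]
  have := hM q hq
  linarith

/-! ## §3. The per-term obligations of a (P4) Gram leaf from `W`-level data (appended, hand-1 g19) -/

/-- ★★ **PER-TERM HYPOTHESES OF `boxSum_ge_of_gramLeaf` FROM `W`, `W′`, `W″` ON `[√a, √b]`.**  On a q-interval `[a,b] ⊂ (0,∞)`: if `W` has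
derivative `W₁(√q)` and `W₁` has derivative `W₂(√q)` at `√q` for every `q ∈ [a,b]`, and the interval datum `−4·M·(√q)³ ≤ W₂(√q)·√q − W₁(√q)` holds
there, then `φ = W ∘ √` has derivative `φ′ t = W₁(√t)/(2√t)` on `[a,b]` AND `φ′ + M·id` is monotone on `[a,b]` — exactly the `hd`/`hmono`
inputs of `…HomCentredForm.leaf_sound_box` / `…HomGram.boxSum_ge_of_gramLeaf` / `…HomGramHcp.boxSumHcp_ge_of_gramLeaf` for that term. [folklore] -/
theorem gramLeaf_term_hyps {W W₁ W₂ : ℝ → ℝ} {M a b : ℝ} (ha : 0 < a)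
    (hW1 : ∀ q ∈ Set.Icc a b, HasDerivAt W (W₁ (Real.sqrt q)) (Real.sqrt q))
    (hW2 : ∀ q ∈ Set.Icc a b, HasDerivAt W₁ (W₂ (Real.sqrt q)) (Real.sqrt q))
    (hM : ∀ q ∈ Set.Icc a b, -(4 * M * Real.sqrt q ^ 3) ≤ W₂ (Real.sqrt q) * Real.sqrt q - W₁ (Real.sqrt q)) :
    (∀ t ∈ Set.Icc a b, HasDerivAt (fun q => W (Real.sqrt q)) (W₁ (Real.sqrt t) / (2 * Real.sqrt t)) t) ∧
      MonotoneOn (fun t => W₁ (Real.sqrt t) / (2 * Real.sqrt t) + M * t) (Set.Icc a b) := by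
  refine ⟨fun t ht => hasDerivAt_comp_sqrt (ha.trans_le ht.1).ne' (hW1 t ht), ?_⟩
  obtain ⟨hd2, hbound⟩ := le_deriv2_of_bound ha hW2 hM
  exact FrustratedLawDichotomyStrainedPatchHomCentredForm.monotoneOn_deriv_add_mul_of_le_deriv2 hd2 hbound

end Summit.AtomisticToContinuum.Crystallization.Theorems.FrustratedLawDichotomyStrainedPatchHomLeafCalculus

end
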